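import Summits.NavierStokesRegularity.NavierStokesRegularity.Theorems.ExtremiserTransienceMemberSelection
import HarnessLib

/-!
# Route `ExtremiserTransience`, crux `NearExtremalTransiencePerFlow` (stmt-NavierStokesRegularity-26567),
# LINE g11-α «Leray pincer» (ideator ns-idea-5 g11): THE VOCABULARY OF THE STUBS T, Q♭ (texts of record)

Texts of record, VERBATIM §1 of the critic-passed crux workfile `Cruxes/NearExtremalTransiencePerFlow/Lines/leray_pincer.lean`
(planner ns-idea-5 g11, crux-write commit b600d09ae385; idea-crit-4 g8 VERDICT 2026-08-29T09:11:26Z = PASS, grade B+; files-only line,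
nothing registered — the skeleton of record on ⟨26567⟩ stays γ `multiscale_crowding`), so that the line's two stubs and its ladder weld
`26567 ⇐ T ∧ QuarterLawTypeI (23726)` can be stated BY NAME in `Theorems/` files (a `Cruxes/` file is not importable from `Theorems/`):

* `TightOfBoundedBudget` (STUB T, static, size L) — a near-extremal height-`1` family with eventual linear growth and bounded enstrophy
  budgets along a subsequence has a translate-subsequence converging pointwise to an exact extremiser `IsExtremalSlice`;
* `LerayRateOnEfficientTimes` (STUB Q♭, flow heart) — Leray-rate saturation `Z(tₙ)√(T−tₙ) ≤ K` infinitely often along the near-efficient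
  no-dust times of a Type-I violator;
* `QuarterLawOnViolators` — the violator form of the ladder rung `TypeIQuarterGate.QuarterLawTypeI` (stmt-NavierStokesRegularity-23726),
  recorded to show where Q♭ sits (not a stub);
* `StrongPointBudget` — the first lemma of T, typed (not a stub, not used by the skeleton).

All four are phrased over landed vocabulary (`MemberSelection.NearExtremalFamily / EfficientTimesData / IsExtremalSlice`,
`ZoneTransversality.IsViolator`, `KStar.HalfSpace.E3`); nothing new is posited.
Author of the port: prover seat `ns-net-p1` (g14).  HONEST FRAMING: definitions only; nothing about Navier–Stokes regularity or blow-up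
is proved here; no summit is proved by a line.
-/

noncomputable section

open scoped Topology InnerProductSpace RealInnerProductSpace ENNReal ContDiff
open MeasureTheory Filter Set Metric Function
open Literature.Analysis Literature.Analysis.FluidPDE
open Summit.NavierStokesRegularity.NavierStokesRegularity.Theorems.DepletionLadder.KStar.HalfSpace
open Summit.NavierStokesRegularity.NavierStokesRegularity.Theorems.NearExtremalTransiencePerFlow.ZoneTransversality
open Summit.NavierStokesRegularity.NavierStokesRegularity.Theorems.NearExtremalTransiencePerFlow.MemberSelection

namespace Summit.NavierStokesRegularity.NavierStokesRegularity.Theorems.NearExtremalTransiencePerFlow.LerayPincer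

-- the problem directory repeats the summit name (`NavierStokesRegularity/NavierStokesRegularity`)
set_option linter.dupNamespace false

/-- **STUB T — «bounded budget forces an extremal limit»** (static; size L).  A near-extremal height-`1` family
(`NearExtremalFamily`: smooth, divergence-free, `‖v n‖ ≤ 1`, all derivatives uniformly bounded, finite `Ḣ¹, Ḣ²` budgets, efficiency
deficit `ε n → 0`, Taylor bound) with eventual linear local-energy growth whose ENSTROPHY BUDGETS are bounded along a subsequence has
centres `y`, a subsequence `φ` and a pointwise translate-limit `W₀` that is an exact extremiser of the sharp depletion inequality.
(Verbatim the line's `TightOfBoundedBudget`.) -/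
def TightOfBoundedBudget : Prop :=
  ∀ (v : ℕ → E3 → E3) (Λ : ℕ → ℝ) (Θ : ℝ) (ε : ℕ → ℝ) (A Zb : ℝ),
    NearExtremalFamily v Λ Θ ε →
    (∀ᶠ n in atTop, ∀ (x : E3) (R : ℝ), 0 < R → ∫ z in Metric.ball x R, ‖v n z‖ ^ 2 ≤ A * R) →
    (∃ᶠ n in atTop, ∫ x, ‖curl (v n) x‖ ^ 2 ≤ Zb) →
    ∃ (y : ℕ → E3) (φ : ℕ → ℕ) (W₀ : E3 → E3), StrictMono φ ∧
      (∀ z : E3, Tendsto (fun n => v (φ n) (y (φ n) + z)) atTop (𝓝 (W₀ z))) ∧ IsExtremalSlice W₀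

/-- **STUB Q♭ — «Leray-rate saturation on the efficient times»** (flow HEART; open, strictly below `QuarterLawTypeI`).  For a Type-I
violator (`IsViolator`) and ANY near-efficient no-dust data (`EfficientTimesData`), the enstrophy saturates Leray's lower rate
infinitely often along the data: `Z(tₙ)·√(T − tₙ) ≤ K`.  (Verbatim the line's `LerayRateOnEfficientTimes`.) -/
def LerayRateOnEfficientTimes : Prop :=
  ∀ (C ν T : ℝ) (u : ℝ → E3 → E3) (p : ℝ → E3 → ℝ), IsViolator C ν T u p →
    ∀ (Θ : ℝ) (t Mb ε : ℕ → ℝ), EfficientTimesData ν T u Θ t Mb ε →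
      ∃ K : ℝ, ∃ᶠ n in atTop, (∫ x, ‖curl (u (t n)) x‖ ^ 2) * Real.sqrt (T - t n) ≤ K

/-- The QUARTER LAW in violator form (the shape of `TypeIQuarterGate.QuarterLawTypeI`, stmt-NavierStokesRegularity-23726, with
`IsMaximalSmoothSolution` unfolded to `classical ∧ ¬extension`, `IsTypeIBlowup` specialised to the violator's eventual rate and the
enstrophy written as a Bochner integral): `Z(t) √(T−t) ≤ K` on all of `[0, T)`.  Not a stub of the line — recorded to show where Q♭
sits on the ladder.  (Verbatim the line's `QuarterLawOnViolators`.) -/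
def QuarterLawOnViolators : Prop :=
  ∀ (C ν T : ℝ) (u : ℝ → E3 → E3) (p : ℝ → E3 → ℝ), IsViolator C ν T u p →
    ∃ K : ℝ, ∀ t ∈ Set.Ico 0 T, (∫ x, ‖curl (u t) x‖ ^ 2) * Real.sqrt (T - t) ≤ K

/-- The first lemma of stub T, typed (NOT a stub, not used by the skeleton): an `η`-strong point of a bounded divergence-free field with
square-integrable vorticity and linear local-energy growth carries local enstrophy `≥ c` within a bounded distance `D`, with `c, D`
depending only on `η`, the budget bound, the gradient bound and the growth constant.  (Verbatim the line's `StrongPointBudget`.) -/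
def StrongPointBudget : Prop :=
  ∀ (η Zb B A : ℝ), 0 < η → 0 < Zb → 0 < B → 0 < A →
    ∃ (c D : ℝ), 0 < c ∧ 0 < D ∧
      ∀ (v : E3 → E3), ContDiff ℝ (⊤ : ℕ∞) v → VectorCalculus.IsDivFree v → (∀ x, ‖v x‖ ≤ 1) →
        (∀ x, ‖fderiv ℝ v x‖ ≤ B) → (∫ x, ‖curl v x‖ ^ 2 ≤ Zb) → (∫⁻ x, ‖iteratedFDeriv ℝ 1 v x‖ₑ ^ 2 < ⊤) →
        (∀ (x : E3) (R : ℝ), 0 < R → ∫ z in Metric.ball x R, ‖v z‖ ^ 2 ≤ A * R) →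
        ∀ x₀ : E3, η ≤ ‖v x₀‖ → c ≤ ∫ z in Metric.ball x₀ D, ‖curl v z‖ ^ 2

end Summit.NavierStokesRegularity.NavierStokesRegularity.Theorems.NearExtremalTransiencePerFlow.LerayPincer

end
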